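import Summits.Schanuel.Schanuel.Theorems.ZilberEacParamSurfaceCase
import Summits.Schanuel.Schanuel.Theorems.ZilberEacGraphCurveInstances
import HarnessLib

/-!
# Polynomially parametrised base curves, XIV: a non-split example — the breathing circle over the
# cusp, `{(t², t³, y) : t (y₀² + y₁² - 2) + 1 = 0}`

HONEST FRAMING.  Cell `pub-schanuel` (Zilber's Exponential-Algebraic Closedness, case ladder;
host summit Schanuel), seat 2, gen 19.  An explicit NON-SPLIT surface of Mantova–Masser's case over
the cuspidal cubic `x₀³ = x₁²`: the fibre over the parameter `t` is the circle
`y₀² + y₁² = 2 - 1/t`, whose radius moves with `t`.  `Q = t (y₀² + y₁² - 2) + 1` is irreducible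
(Part A: `t F(y) + c` with `F ≠ 0`, `c ≠ 0` is irreducible — a degree-one polynomial in `t` over
`ℂ[y]` whose constant coefficient is a unit), `t`-equidegree on its `y`-support (`N = 1`), with
torus fibres over every `t ∉ {0, 1}`; so the surface is in case (dim-π-S-1-free) AND its
exponential points are Zariski dense (`unprojectedDensityQuestion_instance_cusp_breathingCircle`).
An instance of an OPEN question (PLMS 2024 §1 p. 5); NOT Schanuel's conjecture (neither used nor
implied; EAC ⇏ SC); `EC(3,2)` stays OPEN.
-/

noncomputable section

open Complex MvPolynomial
open Literature.NumberTheory.Transcendental Literature.ModelTheory.Zilber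
open Literature.ModelTheory.ExponentialFields

set_option linter.dupNamespace false

namespace Summit.Schanuel.Schanuel.Theorems

/-! ## Part A. `t · F(y) + c` is irreducible -/

/-- Over a domain, `a X + u` with `a ≠ 0` and `u` a unit is irreducible. -/
theorem irreducible_C_mul_X_add_C_of_isUnit {R : Type*} [CommRing R] [IsDomain R] {a u : R}
    (ha : a ≠ 0) (hu : IsUnit u) :
    Irreducible (Polynomial.C a * Polynomial.X + Polynomial.C u) := by
  set p : Polynomial R := Polynomial.C a * Polynomial.X + Polynomial.C u with hp
  have hdeg : p.natDegree = 1 := Polynomial.natDegree_linear ha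
  have hp0 : p ≠ 0 := by
    intro h; rw [h, Polynomial.natDegree_zero] at hdeg; exact zero_ne_one hdeg
  have hcoeff0 : p.coeff 0 = u := by simp [hp]
  refine ⟨fun hunit => ?_, fun f g hfg => ?_⟩
  · obtain ⟨r, -, hr⟩ := Polynomial.isUnit_iff.1 hunit
    have := congrArg Polynomial.natDegree hr
    rw [Polynomial.natDegree_C, hdeg] at this
    exact zero_ne_one this
  · have hf0 : f ≠ 0 := by rintro rfl; exact hp0 (by rw [hfg, zero_mul])
    have hg0 : g ≠ 0 := by rintro rfl; exact hp0 (by rw [hfg, mul_zero])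
    have hsum : f.natDegree + g.natDegree = 1 := by
      rw [← Polynomial.natDegree_mul hf0 hg0, ← hfg, hdeg]
    have hc0 : f.coeff 0 * g.coeff 0 = u := by rw [← Polynomial.mul_coeff_zero, ← hfg, hcoeff0]
    rcases Nat.eq_zero_or_pos f.natDegree with hf | hf
    · left
      rw [Polynomial.eq_C_of_natDegree_eq_zero hf, Polynomial.isUnit_C]
      exact isUnit_of_dvd_unit (Dvd.intro _ hc0) hu
    · right
      have hg : g.natDegree = 0 := by omega
      rw [Polynomial.eq_C_of_natDegree_eq_zero hg, Polynomial.isUnit_C]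
      exact isUnit_of_dvd_unit (Dvd.intro_left _ hc0) hu

/-- Under `finSuccEquiv` (`t ↦ X`, `yᵢ ↦ C yᵢ`): `rename succ F ↦ C F`. -/
theorem finSuccEquiv_rename_succ (F : MvPolynomial (Fin 2) ℂ) :
    MvPolynomial.finSuccEquiv ℂ 2 (rename Fin.succ F) = Polynomial.C F := by
  have h : ((MvPolynomial.finSuccEquiv ℂ 2).toAlgHom.comp (rename Fin.succ) :
      MvPolynomial (Fin 2) ℂ →ₐ[ℂ] Polynomial (MvPolynomial (Fin 2) ℂ)) = Polynomial.CAlgHom := by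
    refine MvPolynomial.algHom_ext fun i => ?_
    simp [MvPolynomial.finSuccEquiv_X_succ]
  have := congrArg (fun φ => φ F) h
  simpa using this

/-- **`t · F(y₀, y₁) + c` is irreducible** in `ℂ[t, y₀, y₁]` for `F ≠ 0`, `c ≠ 0`. (new) -/
theorem irreducible_X0_mul_rename_add_C {F : MvPolynomial (Fin 2) ℂ} (hF : F ≠ 0) {c : ℂ}
    (hc : c ≠ 0) :
    Irreducible (X 0 * rename Fin.succ F + MvPolynomial.C c : MvPolynomial (Fin 3) ℂ) := by
  have himage : MvPolynomial.finSuccEquiv ℂ 2 (X 0 * rename Fin.succ F + MvPolynomial.C c) =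
      Polynomial.C F * Polynomial.X + Polynomial.C (MvPolynomial.C c) := by
    rw [map_add, map_mul, MvPolynomial.finSuccEquiv_X_zero, finSuccEquiv_rename_succ, mul_comm]
    congr 1
    have := congrArg (fun φ : ℂ →+* MvPolynomial (Fin 3) ℂ => φ c)
      (MvPolynomial.finSuccEquiv_comp_C_eq_C (R := ℂ) 2)
    simp only [RingHom.comp_apply] at this
    rw [← this, RingHom.coe_coe, AlgEquiv.apply_symm_apply]
  have hirr := irreducible_C_mul_X_add_C_of_isUnit (R := MvPolynomial (Fin 2) ℂ) hF
    ((isUnit_iff_ne_zero.2 hc).map MvPolynomial.C)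
  rw [← himage] at hirr
  exact (MulEquiv.irreducible_iff (MvPolynomial.finSuccEquiv ℂ 2).toMulEquiv).1 hirr

/-! ## Part B. The breathing circle over the cusp -/

section Breathing

/-- `Q = t (y₀² + y₁² - 2) + 1` as a sum of monomials. -/
theorem breathingQ_eq_monomials :
    (X 0 * (X 1 ^ 2 + X 2 ^ 2 - MvPolynomial.C 2) + MvPolynomial.C 1 : MvPolynomial (Fin 3) ℂ) =
      MvPolynomial.monomial (Finsupp.single 0 1 + Finsupp.single 1 2) 1 +
        MvPolynomial.monomial (Finsupp.single 0 1 + Finsupp.single 2 2) 1 -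
        MvPolynomial.monomial (Finsupp.single 0 1) 2 + MvPolynomial.monomial 0 1 := by
  simp only [MvPolynomial.X_pow_eq_monomial]
  simp only [MvPolynomial.X, MvPolynomial.C_apply, mul_add, mul_sub, MvPolynomial.monomial_mul, one_mul,
    add_zero]

/-- The coefficients of `Q`. -/
theorem coeff_breathingQ (m : Fin 3 →₀ ℕ) :
    MvPolynomial.coeff m
        (X 0 * (X 1 ^ 2 + X 2 ^ 2 - MvPolynomial.C 2) + MvPolynomial.C 1 : MvPolynomial (Fin 3) ℂ) =
      (if Finsupp.single 0 1 + Finsupp.single 1 2 = m then 1 else 0) +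
        (if Finsupp.single 0 1 + Finsupp.single 2 2 = m then 1 else 0) -
        (if Finsupp.single (0 : Fin 3) 1 = m then 2 else 0) + (if (0 : Fin 3 →₀ ℕ) = m then 1 else 0) := by
  rw [breathingQ_eq_monomials]
  simp only [MvPolynomial.coeff_add, MvPolynomial.coeff_sub, MvPolynomial.coeff_monomial]

/-- `t y₀² ≠ t y₁²` (exponent vectors). -/
theorem bq_ne_12 : (Finsupp.single (0 : Fin 3) 1 + Finsupp.single 1 2 : Fin 3 →₀ ℕ) ≠
    Finsupp.single 0 1 + Finsupp.single 2 2 := by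
  intro h; have := DFunLike.congr_fun h 1; simp at this
/-- `t y₀² ≠ t` (exponent vectors). -/
theorem bq_ne_10 : (Finsupp.single (0 : Fin 3) 1 + Finsupp.single 1 2 : Fin 3 →₀ ℕ) ≠
    Finsupp.single 0 1 := by
  intro h; have := DFunLike.congr_fun h 1; simp at this
/-- `t y₀² ≠ 1` (exponent vectors). -/
theorem bq_ne_1z : (Finsupp.single (0 : Fin 3) 1 + Finsupp.single 1 2 : Fin 3 →₀ ℕ) ≠ 0 := by
  intro h; have := DFunLike.congr_fun h 1; simp at this
/-- `t y₁² ≠ t` (exponent vectors). -/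
theorem bq_ne_20 : (Finsupp.single (0 : Fin 3) 1 + Finsupp.single 2 2 : Fin 3 →₀ ℕ) ≠
    Finsupp.single 0 1 := by
  intro h; have := DFunLike.congr_fun h 2; simp at this
/-- `t y₁² ≠ 1` (exponent vectors). -/
theorem bq_ne_2z : (Finsupp.single (0 : Fin 3) 1 + Finsupp.single 2 2 : Fin 3 →₀ ℕ) ≠ 0 := by
  intro h; have := DFunLike.congr_fun h 2; simp at this
/-- `t ≠ 1` (exponent vectors). -/
theorem bq_ne_0z : (Finsupp.single (0 : Fin 3) 1 : Fin 3 →₀ ℕ) ≠ 0 := by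
  intro h; have := DFunLike.congr_fun h 0; simp at this

/-- The support of `Q` lies in `{t y₀², t y₁², t, 1}`. -/
theorem support_breathingQ_subset {m : Fin 3 →₀ ℕ}
    (hm : m ∈ (X 0 * (X 1 ^ 2 + X 2 ^ 2 - MvPolynomial.C 2) + MvPolynomial.C 1 :
      MvPolynomial (Fin 3) ℂ).support) :
    m = Finsupp.single 0 1 + Finsupp.single 1 2 ∨ m = Finsupp.single 0 1 + Finsupp.single 2 2 ∨
      m = Finsupp.single 0 1 ∨ m = 0 := by
  rw [MvPolynomial.mem_support_iff, coeff_breathingQ] at hm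
  by_contra h
  push Not at h
  obtain ⟨h1, h2, h3, h4⟩ := h
  rw [if_neg (Ne.symm h1), if_neg (Ne.symm h2), if_neg (Ne.symm h3), if_neg (Ne.symm h4)] at hm
  norm_num at hm

/-- `t y₀²`, `t y₁²`, `t` are monomials of `Q`. -/
theorem mem_support_breathingQ :
    (Finsupp.single 0 1 + Finsupp.single 1 2 : Fin 3 →₀ ℕ) ∈
        (X 0 * (X 1 ^ 2 + X 2 ^ 2 - MvPolynomial.C 2) + MvPolynomial.C 1 : MvPolynomial (Fin 3) ℂ).support ∧
      (Finsupp.single 0 1 + Finsupp.single 2 2 : Fin 3 →₀ ℕ) ∈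
        (X 0 * (X 1 ^ 2 + X 2 ^ 2 - MvPolynomial.C 2) + MvPolynomial.C 1 : MvPolynomial (Fin 3) ℂ).support ∧
      (Finsupp.single 0 1 : Fin 3 →₀ ℕ) ∈
        (X 0 * (X 1 ^ 2 + X 2 ^ 2 - MvPolynomial.C 2) + MvPolynomial.C 1 : MvPolynomial (Fin 3) ℂ).support := by
  refine ⟨?_, ?_, ?_⟩ <;> rw [MvPolynomial.mem_support_iff, coeff_breathingQ]
  · rw [if_pos rfl, if_neg bq_ne_12.symm, if_neg bq_ne_10.symm, if_neg bq_ne_1z.symm]; norm_num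
  · rw [if_neg bq_ne_12, if_pos rfl, if_neg bq_ne_20.symm, if_neg bq_ne_2z.symm]; norm_num
  · rw [if_neg bq_ne_10, if_neg bq_ne_20, if_pos rfl, if_neg bq_ne_0z.symm]; norm_num

/-- **`Q = t (y₀² + y₁² - 2) + 1` is irreducible.** -/
theorem irreducible_breathingQ :
    Irreducible (X 0 * (X 1 ^ 2 + X 2 ^ 2 - MvPolynomial.C 2) + MvPolynomial.C 1 : MvPolynomial (Fin 3) ℂ) := by
  have hF : (X 0 ^ 2 + X 1 ^ 2 - MvPolynomial.C 2 : MvPolynomial (Fin 2) ℂ) ≠ 0 :=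
    (irreducible_circlePoly two_ne_zero).ne_zero
  have h := irreducible_X0_mul_rename_add_C hF one_ne_zero
  have e : (rename Fin.succ (X 0 ^ 2 + X 1 ^ 2 - MvPolynomial.C 2 : MvPolynomial (Fin 2) ℂ) :
      MvPolynomial (Fin 3) ℂ) = X 1 ^ 2 + X 2 ^ 2 - MvPolynomial.C 2 := by
    simp [MvPolynomial.rename_X]
  rw [e] at h
  exact h

/-- Torus fibres of `Q` over every `t ∉ {0, 1}`: `y = (√(1 - 1/t), 1)`. -/
theorem breathingQ_torusFibres_infinite :
    Set.Infinite {t : ℂ | ∃ c : Fin 2 → ℂ, c 0 ≠ 0 ∧ c 1 ≠ 0 ∧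
      MvPolynomial.eval ![t, c 0, c 1]
        (X 0 * (X 1 ^ 2 + X 2 ^ 2 - MvPolynomial.C 2) + MvPolynomial.C 1 : MvPolynomial (Fin 3) ℂ) = 0} := by
  have hfin : ({0, 1} : Set ℂ).Finite := by simp
  refine (hfin.infinite_compl).mono ?_
  intro t ht
  simp only [Set.mem_compl_iff, Set.mem_insert_iff, Set.mem_singleton_iff, not_or] at ht
  obtain ⟨ht0, ht1⟩ := ht
  obtain ⟨z, hz⟩ := IsAlgClosed.exists_pow_nat_eq (1 - 1 / t) (by norm_num : 0 < 2)
  have hne : (1 : ℂ) - 1 / t ≠ 0 := by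
    rw [sub_ne_zero, ne_comm, Ne, div_eq_one_iff_eq ht0]
    exact fun h => ht1 h.symm
  have hz0 : z ≠ 0 := by
    rintro rfl
    rw [zero_pow two_ne_zero] at hz
    exact hne hz.symm
  refine ⟨![z, 1], by simpa using hz0, by simp, ?_⟩
  simp only [map_add, map_mul, map_sub, map_pow, MvPolynomial.eval_X, MvPolynomial.eval_C,
    Matrix.cons_val_zero, Matrix.cons_val_one, Matrix.cons_val_two, Matrix.tail_cons,
    Matrix.head_cons]
  rw [hz]
  field_simp
  ring

/-- **The breathing circle over the cusp.**  The NON-SPLIT surface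
`S = {(t², t³, y₀, y₁) : t (y₀² + y₁² - 2) + 1 = 0} ⊆ ℂ² × ℂ²` (base the cuspidal cubic
`x₀³ = x₁²`, fibre over `t` the circle of squared radius `2 - 1/t`) is in Mantova–Masser's case
(dim-π-S-1-free) AND its exponential points are Zariski dense.
[cite: MantovaMasser2023, §1 Further remarks, p. 5 (the question, open in general)] (new) -/
theorem unprojectedDensityQuestion_instance_cusp_breathingCircle :
    MMCaseDimPiOneFree {w : Fin 2 ⊕ Fin 2 → ℂ | ∃ t : ℂ,
        w (Sum.inl 0) = (Polynomial.X ^ 2 : Polynomial ℂ).eval t ∧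
        w (Sum.inl 1) = (Polynomial.X ^ 3 : Polynomial ℂ).eval t ∧
        MvPolynomial.eval (Fin.cases t (fun i => w (Sum.inr i)) : Fin 3 → ℂ)
          (X 0 * (X 1 ^ 2 + X 2 ^ 2 - MvPolynomial.C 2) + MvPolynomial.C 1 : MvPolynomial (Fin 3) ℂ) = 0} ∧
      UnprojectedDense {w : Fin 2 ⊕ Fin 2 → ℂ | ∃ t : ℂ,
        w (Sum.inl 0) = (Polynomial.X ^ 2 : Polynomial ℂ).eval t ∧
        w (Sum.inl 1) = (Polynomial.X ^ 3 : Polynomial ℂ).eval t ∧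
        MvPolynomial.eval (Fin.cases t (fun i => w (Sum.inr i)) : Fin 3 → ℂ)
          (X 0 * (X 1 ^ 2 + X 2 ^ 2 - MvPolynomial.C 2) + MvPolynomial.C 1 : MvPolynomial (Fin 3) ℂ) = 0} := by
  obtain ⟨h₁, h₂, h₀⟩ := mem_support_breathingQ
  refine unprojectedDensityQuestion_instance_paramSurface₃_of_equidegree (Polynomial.X ^ 2)
    (Polynomial.X ^ 3) (by simp) (by simp) irreducible_breathingQ
    ⟨_, h₂, _, h₀, by simp⟩ 1 (fun m hm => ?_) (fun m hm => ?_) breathingQ_torusFibres_infinite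
  · rcases support_breathingQ_subset hm with rfl | rfl | rfl | rfl <;> simp
  · rcases support_breathingQ_subset hm with rfl | rfl | rfl | rfl
    · exact ⟨_, h₁, by simp, by simp, by simp⟩
    · exact ⟨_, h₂, by simp, by simp, by simp⟩
    · exact ⟨_, h₀, by simp, by simp, by simp⟩
    · exact ⟨_, h₀, by simp, by simp, by simp⟩

end Breathing

end Summit.Schanuel.Schanuel.Theorems
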